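import Summits.CriticalPhenomena.PercolationContinuityZ3.Theorems.NearLinearTwoClusterDecay.Negative.Dichotomy
import Summits.CriticalPhenomena.PercolationContinuityZ3.Theorems.NearLinearTwoClusterDecay.Negative.CrossingCertainJ
import Summits.CriticalPhenomena.PercolationContinuityZ3.Theorems.PercBudgetLadderBlockingVanishesOfTheta
import HarnessLib

/-!
# In any jump world, two in-box-distinct critical crossing clusters of BOUNDED aspect are never rare
# (vdBvE programme, brick V6 = Lemma 6 of arXiv:2009.13337 read at `p_c` under `θ(p_c) > 0`)

Negative-side structure for the crux `NearLinearTwoClusterDecay` (stmt-CriticalPhenomena-5785), line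
`critical-orange-peeling`, lead seat c2.  The route `PercShatteringRace` consumes the crux `U(1/6)`
("`P_{p_c}(A₂(n, ⌈n^{7/6}⌉)) → 0`") ONLY in the counterfactual world `θ(p_c) > 0` (through
`JumpUniquenessBoxLRO`).  This file certifies what that world does to the BOUNDED-aspect version of the
same event:

* `twoCluster_boundedAspect_of_theta_pos` : if `θ(p_c) > 0` on `ℤ³` then for every `M ≥ 1` there is
  `ε(M) > 0` with `ε ≤ P_{p_c}(A₂(4n, 4Mn))` for ALL LARGE `n`.

So a jump world pins the two-cluster probability AWAY FROM ZERO at every bounded aspect: any proof of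
`U` usable by the race must exploit the growth `m/n = n^{1/6} → ∞` of the aspect against an adversary
in which bounded-aspect local non-uniqueness has probability `≥ ε(M)` at all large scales (the
"sparse-rung ladder" cartoon of the crux's AtomCensus §3.6, now a theorem on its quantitative side).
Proof: the critical dichotomy `ε ≤ P_{p_c}(Λ(n) ↮ ∂ⁱⁿΛ(16Mn)) + P_{p_c}(A₂(4n,4Mn))`
(`critTwoCluster_dichotomy`, every `n ≥ 1`) and `P_{p_c}(Λ(n) ↮ ∂ⁱⁿΛ(16Mn)) ≤ P_{p_c}(Λ(n) ↮ ∞) → 0`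
under `θ(p_c) > 0` (zero–one law; `real_annulus_blocked_le_real_compl_boxPerc`, `GM.tendsto_prob_not_boxPerc`).
Unconditionally the first alternative does occur along scales (it is the seed of Prop. 2's second
mechanism), which is why this statement is genuinely conditional.
-/

noncomputable section

namespace Summit.CriticalPhenomena.PercolationContinuityZ3.Theorems.NearLinearTwoClusterDecay.Negative

open MeasureTheory Filter Topology
open Literature.Probability.LatticeModels Literature.Probability.Percolation

/-- **Jump world ⇒ bounded-aspect two-cluster positivity at all large scales.** If `θ(p_c) > 0` on `ℤ³`,
then for every `M ≥ 1` there is `ε > 0` such that, for all large `n`, with probability `≥ ε` at `p_c`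
the box `Λ(4Mn)` contains two in-box-distinct open clusters each joining `Λ(4n)` to `∂ⁱⁿΛ(4Mn)`.
[cite: VandenbergVanengelenburg2022, Lemma 6 and Observation 8 (the renormalisation behind Prop. 2)] -/
theorem twoCluster_boundedAspect_of_theta_pos
    (hθ : 0 < theta (zdGraph 3) (0 : Site 3) (criticalProbI 3)) :
    ∀ M : ℕ, 1 ≤ M → ∃ ε : ℝ, 0 < ε ∧ ∀ᶠ n : ℕ in atTop,
      ε ≤ (bondPercolation (zdGraph 3) (criticalProbI 3)).real
          {ω | ∃ x ∈ box 3 (4 * n), ∃ x' ∈ box 3 (4 * n),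
            ∃ y ∈ innerBoundary (zdGraph 3) (box 3 (4 * M * n)),
            ∃ y' ∈ innerBoundary (zdGraph 3) (box 3 (4 * M * n)),
              ω ∈ openConnIn (↑(box 3 (4 * M * n)) : Set (Site 3)) x y ∧
              ω ∈ openConnIn (↑(box 3 (4 * M * n)) : Set (Site 3)) x' y' ∧
              ω ∉ openConnIn (↑(box 3 (4 * M * n)) : Set (Site 3)) x x'} := by
  intro M hM
  obtain ⟨ε, hε, hdich⟩ := critTwoCluster_dichotomy M hM
  refine ⟨ε / 2, half_pos hε, ?_⟩
  -- the one-arm alternative dies in the jump world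
  have hblock : Tendsto (fun n : ℕ => (bondPercolation (zdGraph 3) (criticalProbI 3)).real
      {ω | ¬ ∃ x ∈ box 3 n, ∃ y ∈ innerBoundary (zdGraph 3) (box 3 (16 * M * n)),
        ω ∈ openConnIn (↑(box 3 (16 * M * n)) : Set (Site 3)) x y}) atTop (𝓝 0) :=
    tendsto_of_tendsto_of_tendsto_of_le_of_le tendsto_const_nhds
      (GM.tendsto_prob_not_boxPerc (d := 3) (criticalProbI 3) hθ) (fun _ => measureReal_nonneg)
      fun n => real_annulus_blocked_le_real_compl_boxPerc (criticalProbI 3)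
        (l := 16 * M) (by omega) n
  filter_upwards [hblock.eventually (gt_mem_nhds (half_pos hε)), eventually_ge_atTop 1] with n hn hn1
  have := hdich n hn1
  linarith

end Summit.CriticalPhenomena.PercolationContinuityZ3.Theorems.NearLinearTwoClusterDecay.Negative

end
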